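import Literature.AlgebraicGeometry.AbelianSchemes.AbelianSchemeQuotientPoincareIsotropyOfIdealTorsion
import Literature.AlgebraicGeometry.AbelianSchemes.PoincareStabilizerOfSubgroupImage
import Literature.AlgebraicGeometry.AbelianSchemes.AbelianSchemeQuotientDualPairRigidified
import Literature.AlgebraicGeometry.AbelianSchemes.AbelianSchemeQuotientDualPairUniversalOfLevelDesc
import Literature.AlgebraicGeometry.AbelianSchemes.PoincarePullbackStabilizerOfLevelGeometric
import Literature.AlgebraicGeometry.AbelianSchemes.AbelianSchemeConstSubgroupQuotientOfField
import Literature.AlgebraicGeometry.AbelianSchemes.AbelianSchemeQuotientIsoOfKernelRank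
import Literature.AlgebraicGeometry.AbelianSchemes.AbelianSchemeDualTransportUnit
import Literature.AlgebraicGeometry.AbelianSchemes.AbelianSchemeQuotientPoincareEquivariant
import Literature.AlgebraicGeometry.AbelianSchemes.PolarizationLamTranslationInvariance
import Literature.AlgebraicGeometry.AbelianSchemes.AbelianSchemeQuotientIsLambdaOfAtSq
import HarnessLib

/-!
# «DUAL-Q»: the dual pair of `A ∕ A[𝔟]` over an algebraically closed field, with dual `Â ∕ λ_*A[𝔠]` (`𝔠·𝔟̄ = (n)`, `p ∤ n`), from Rosati rows
# ([MumfordAV1970] §15 Thm. 1 (p. 143), §23 Thm. 2 (p. 231); [MilneAV2008] I §8–§9; [MumfordFogartyKirwan1994] Ch. 6 §2, Ch. 7 §2 Def. 7.1)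

Layer `Literature/AlgebraicGeometry/AbelianSchemes`, namespace `Literature.AlgebraicGeometry.AbelianSchemes.AbelianSchemeOver`.
THEOREMS ONLY (no definition, no named fact, no instance, no `sorry`).  Cell `hodgecm-mathlib` (D-0151), P6 «MOD programme», crux hLiu418
(`stmt-HodgeConjecture-24832`, `--supports`, count-neutral), line L3 ROOF road «DUAL-B̄», LA3-plan RULING #5 (A) «DUAL-Q» ENGINE ASSEMBLY HEAD.
HC_CM is proved only modulo the 2 remaining named inputs (hLiu418 24832, h413 24833) until rung 0 closes; nothing here is about HC.

THE ASSEMBLY.  Over `S = Spec Ω` (`Ω` algebraically closed), for an abelian scheme `A` of relative dimension `g` with a dual pair `D = (Â, 𝒫)` and an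
`S`-homomorphism `λ : A → Â` which is `Λ(𝒪(Θ))` at every geometric point (`hpol` — a polarisation), an action `ι : 𝒪 → End_S(A)` of a Dedekind domain
whose nonzero elements act by isogenies onto and dominant on geometric fibres (`hsurj`, `hros`), ideals `𝔟`, `𝔟̄ ≠ 0`, `𝔠` with `𝔠·𝔟̄ = (n)`,
`(n : Ω) ≠ 0`, every nonzero `j ∈ 𝔟̄` having a ROSATI PARTNER `b ∈ 𝔟` (`ι(j) ≫ λ = λ ≫ ι(b)^∨`), finite `n`-torsion subgroups `K ≤ A(S)` killed by
`ι(𝔟)` and `K₂ ≤ A(S)` killed by `ι(𝔠)`, `K′ := λ_*K₂ ≤ Â(S)`, a level-`n` structure `φ̂` on `Â` whose constant sections contain `K′` and the count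
`#K·#K′ = n^{2g}`: **the quotient `A∕K` carries a dual pair with dual abelian scheme `Â∕K′`** — ★ `dualPairOfQuotientRigidified` ([MumfordAV1970] §15
Thm. 1 «the dual of `A∕K` is `Â∕K^⊥`») with EVERY engine binder discharged BY NAME at the point base: `hcov`∕`hG`∕`hsm`∕`hgc`∕`hfree` (★
`…ConstSubgroupQuotientOfField`, ★ `translation_free_of_field`) for `A` and for `Â`; `hD` ★ `nonempty_unitHatSlice_iso_of_isLambdaOfAt`; `hK′ ≤ Stab(𝒩₁)`
★ H2 `map_le_poincareStabilizerSubgroup_of_subgroup` fed by ★ `hiso_of_idealTorsion_of_rosati` (the ISOTROPY organ: [MumfordAV1970] §23 Thm. 2 for the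
kernel pair `(A[𝔟], A[n𝔟̄⁻¹])`, Rosati adjunction + `A[𝔠] = ι(𝔟̄)·A[n]`); `Φ` ★ `poincareStabilizerStructure`; `h4` ★ `universal_poincareQuotRigid_of_level_of_desc`
with `hStab` ★ `hStab_of_level_of_natCard_eq_geometric` (characteristic-free (K), `p = 𝟙_{Spec Ω}`) and `hn` ★ `natCast_residueField_ne_zero_of_specMap`.
The two inputs `hK′φ` (constant sections of `φ̂` ⊇ `K′`) and `hcard` stay binders of this edition (census rows (b2), (b1) of the line).

* **`nonempty_dualPair_quotient_idealTorsion_geometric`** (THE HEAD; the dual abelian scheme of the produced pair is `Â∕K′` by ★ `dualPairOfQuotientRigidified_hat`, `rfl`).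
* (ED. 2) **`exists_dualPair_quotient_idealTorsion_geometric_of_unit`** — the same pair TOGETHER WITH ITS UNIT PIN `𝒫_Q|_{Q × {ε}} ≅ 𝒪` (★
  `nonempty_unitHatSlice_dualPairOfQuotientRigidified_iso`), so that the `J12` pin of `Roof₀` can be fed after ★ `DualPair.ofIso`.

## References
* [MumfordAV1970] D. Mumford, *Abelian Varieties* (1970), §7 Thm. 4 (p. 72), §15 Thm. 1 (p. 143), §23 p. 208 and Thm. 2 (p. 231).
* [MilneAV2008] J. S. Milne, *Abelian Varieties* (2008), I §8 pp. 36–37, I §9 Thm. 9.1 (p. 42).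
* [MumfordFogartyKirwan1994] D. Mumford, J. Fogarty, F. Kirwan, *Geometric Invariant Theory*, Ch. 6 §2 Def. 6.2–6.3 (p. 120), Ch. 7 §2 Def. 7.1 (p. 129).
-/

set_option autoImplicit false

noncomputable section

set_option backward.isDefEq.respectTransparency false

universe u v

open CategoryTheory CategoryTheory.Limits AlgebraicGeometry MonoidalCategory CartesianMonoidalCategory
open scoped MonObj

namespace Literature.AlgebraicGeometry.AbelianSchemes.AbelianSchemeOver

open Literature.AlgebraicGeometry.RelativeSpec Literature.AlgebraicGeometry.Motives Literature.AlgebraicGeometry.AbelianVarieties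
  Literature.AlgebraicGeometry.Modules

variable {Ω : Type u} [Field Ω] [IsAlgClosed Ω] (A : AbelianSchemeOver (Spec (.of Ω))) [IsCommMonObj A.X]
  [IsSeparated (A.X.hom ≫ 𝟙 (Spec (.of Ω)))] [LocallyOfFiniteType (A.X.hom ≫ 𝟙 (Spec (.of Ω)))]
  (D : A.DualPair) [IsCommMonObj D.hat.X]
  [IsSeparated (D.hat.X.hom ≫ 𝟙 (Spec (.of Ω)))] [LocallyOfFiniteType (D.hat.X.hom ≫ 𝟙 (Spec (.of Ω)))]

/-- **«DUAL-Q» — THE DUAL PAIR OF `A∕A[𝔟]` OVER AN ALGEBRAICALLY CLOSED FIELD FROM ROSATI ROWS** ([MumfordAV1970] §15 Thm. 1 assembled through the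
tree's quotient-dual engine at the point base `Spec Ω`, `u = 𝟙`; see the module docstring for the discharge of every engine binder).  Remaining inputs:
the polarisation witnesses `hpol`, the action's `hsurj`∕`hros` (Rosati partners `ι(j) ≫ λ = λ ≫ ι(b)^∨` for `j ∈ 𝔟̄ ∖ 0`), `𝔠·𝔟̄ = (n)`, `(n : Ω) ≠ 0`, the
kernels `K ⊆ A[𝔟](S)`, `K₂ ⊆ A[𝔠](S)` (`n`-torsion, finite), a level-`n` structure `φ̂` on `Â` with `λ_*K₂ ⊆ φ̂((ℤ∕n)^{2g})`, and `#K·#λ_*K₂ = n^{2g}`.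
[cite: MumfordAV1970, §15 Thm. 1 (p. 143) and §23 Thm. 2 (p. 231)] [cite: MilneAV2008, I §9 Thm. 9.1 (p. 42)] [cite: MumfordFogartyKirwan1994, Ch. 7 §2 Definition 7.1 (p. 129)] -/
theorem nonempty_dualPair_quotient_idealTorsion_geometric {g : ℕ} (hA : A.IsOfRelDim g) (lam : A.X ⟶ D.hat.X) [IsMonHom lam]
    (hpol : ∀ ⦃Ω' : Type u⦄ [Field Ω'] [IsAlgClosed Ω'] (s : Spec (.of Ω') ⟶ Spec (.of Ω)),
      ∃ Θ : CartierDivisor (A.fibre s).toAbelianVariety.X.left, A.IsLambdaOfAt s D lam Θ)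
    {O : Type v} [CommRing O] [IsDedekindDomain O] (act : A.RingAction O)
    (hsurj : ∀ ⦃Ω' : Type u⦄ [Field Ω'] [IsAlgClosed Ω'] (s : Spec (.of Ω') ⟶ Spec (.of Ω)) (r : O), r ≠ 0 →
      haveI := act.isMonHom r
      Function.Surjective (fun x : (A.fibre s).toAbelianVariety.Points Ω' => AlgPoints.map (fibreHom (act.i r) s).hom.hom.hom x))
    {n : ℕ} (hn0 : (n : Ω) ≠ 0) {𝔟 𝔟' 𝔠 : Ideal O} (h𝔟'0 : 𝔟' ≠ ⊥) (h𝔠 : 𝔠 * 𝔟' = Ideal.span {(n : O)})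
    (hros : ∀ ⦃Ω' : Type u⦄ [Field Ω'] [IsAlgClosed Ω'] (s : Spec (.of Ω') ⟶ Spec (.of Ω)), ∀ j ∈ 𝔟', j ≠ 0 → ∃ b ∈ 𝔟,
      (haveI := act.isMonHom b; IsDominant (AbelianVariety.Hom.toSchemeHom (fibreHom (act.i b) s))) ∧
      (haveI := act.isMonHom b; act.i j ≫ lam = lam ≫ DualPair.dualIsogenyOver (act.i b) D D))
    (K : Subgroup A.Sections) [Finite K] (hK : ∀ σ : K, (σ : A.Sections) ^ n = 1) (hK𝔟 : ∀ (κ : K), ∀ b ∈ 𝔟, (κ : A.Sections) ≫ act.i b = 1)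
    (K₂ : Subgroup A.Sections) [Finite K₂] (hK₂ : ∀ σ : K₂, (σ : A.Sections) ^ n = 1) (hK₂𝔠 : ∀ (σ : K₂), ∀ r ∈ 𝔠, (σ : A.Sections) ≫ act.i r = 1)
    (φ : LevelStructure g n D.hat)
    (hK'φ : ((K₂.map (IsMonHom.monoidHom lam (𝟙_ (Over (Spec (.of Ω)))))) : Set D.hat.Sections) ⊆ Set.range φ.section_)
    (hcard : Nat.card K * Nat.card (K₂.map (IsMonHom.monoidHom lam (𝟙_ (Over (Spec (.of Ω)))))) = n ^ (2 * g)) :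
    Nonempty (A.quotientBy (𝟙 (Spec (.of Ω))) K (A.hcov_of_field K)
      (A.exists_grpObj_isMonHom_quotientMk_of_field K (A.hcov_of_field K))
      (A.smooth_quotientOver_hom_of_field K (A.hcov_of_field K))
      (A.geometricallyConnected_quotientOver_hom (𝟙 (Spec (.of Ω))) K (A.hcov_of_field K))).DualPair := by
  -- ### (0) the total spaces are reduced and locally Noetherian
  haveI : IsReduced A.X.left := A.isReduced_left
  haveI : IsReduced D.hat.X.left := D.hat.isReduced_left
  haveI := A.isSmooth
  haveI := D.hat.isSmooth
  haveI : IsLocallyNoetherian A.X.left := LocallyOfFiniteType.isLocallyNoetherian A.X.hom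
  haveI : IsLocallyNoetherian D.hat.X.left := LocallyOfFiniteType.isLocallyNoetherian D.hat.X.hom
  -- ### (1) the quotient binders for `(A, K)` over the field
  have hcov := A.hcov_of_field K
  have hG := A.exists_grpObj_isMonHom_quotientMk_of_field K hcov
  have hsm := A.smooth_quotientOver_hom_of_field K hcov
  have hgc := A.geometricallyConnected_quotientOver_hom (𝟙 (Spec (.of Ω))) K hcov
  have hfree := A.translation_free_of_field K
  -- ### (2) `K′ := λ_*K₂`, finite, and the quotient binders for `(Â, K′)`
  let K' : Subgroup D.hat.Sections := K₂.map (IsMonHom.monoidHom lam (𝟙_ (Over (Spec (.of Ω)))))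
  haveI : Finite K' := A.finite_map_isMonHom_monoidHom lam K₂
  have hcov' := D.hat.hcov_of_field K'
  have hG' := D.hat.exists_grpObj_isMonHom_quotientMk_of_field K' hcov'
  have hsm' := D.hat.smooth_quotientOver_hom_of_field K' hcov'
  have hgc' := D.hat.geometricallyConnected_quotientOver_hom (𝟙 (Spec (.of Ω))) K' hcov'
  have hfree' := D.hat.translation_free_of_field K'
  -- ### (3) `hD`: the unit slice of `𝒫` along `1 × ε_Â` is trivial (`λ̄ = Λ(𝒪(Θ))` at the closed point)
  obtain ⟨Θ₁, hΘ₁⟩ := hpol (𝟙 (Spec (.of Ω)))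
  have hD := DualPair.nonempty_unitHatSlice_iso_of_isLambdaOfAt D lam hΘ₁
  -- ### (4) `n` is invertible at every geometric point and in every residue field
  have hn : ∀ ⦃Ω' : Type u⦄ [Field Ω'] [IsAlgClosed Ω'] (s : Spec (.of Ω') ⟶ Spec (.of Ω)), (n : Ω') ≠ 0 := by
    intro Ω' _ _ s h
    have c : Ω →+* Ω' := (Spec.preimage s).hom
    exact hn0 ((map_eq_zero_iff c c.injective).1 ((map_natCast c n).trans h))
  have hnres : ∀ s : Spec (.of Ω), (n : (Spec (.of Ω)).residueField s) ≠ 0 := fun s => natCast_residueField_ne_zero_of_specMap (𝟙 (Spec (.of Ω))) s hn0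
  -- ### (5) ISOTROPY: `hiso₂` (★ H3 socket closer) ⇒ `K′ ≤ Stab(𝒩₁)` (★ H2) ⇒ `Φ`
  have hiso₂ := A.hiso_of_idealTorsion_of_rosati (𝟙 (Spec (.of Ω))) K hK hcov hG hsm hgc D hfree lam hA hn hpol act hsurj h𝔟'0 h𝔠 hros hK𝔟 K₂
    hK₂ hK₂𝔠
  have hK'stab := A.map_le_poincareStabilizerSubgroup_of_subgroup (𝟙 (Spec (.of Ω))) K hK hcov hG hsm hgc D hfree hD lam K₂ hK₂ hiso₂
  let Φ := A.poincareStabilizerStructure (𝟙 (Spec (.of Ω))) K hK hcov hG hsm hgc D hfree K' hcov' hK'stab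
  -- ### (6) `h4` from the hat level structure, the count and the characteristic-free (K)
  exact ⟨A.dualPairOfQuotientRigidified (𝟙 (Spec (.of Ω))) K hK hcov hG hsm hgc D hfree K' hcov' hG' hsm' hgc' hfree' Φ
    (A.universal_poincareQuotRigid_of_level_of_desc (𝟙 (Spec (.of Ω))) K hK hcov hG hsm hgc D hfree K' hcov' hG' hsm' hgc' hfree' Φ φ
      hnres hcard hD
      (fun f a a' ha ha' h => A.hStab_of_level_of_natCard_eq_geometric (𝟙 (Spec (.of Ω))) K hK hcov hG hsm hgc D hfree K' hcov' Ω
        (𝟙 (Spec (.of Ω))) hA hn0 hD φ hK'φ hK'stab hcard f a a' ha ha' h))⟩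


/-! ## §2 (ED. 2) The same pair together with its unit pin -/

/-- **THE «DUAL-Q» ENGINE WITH ITS UNIT PIN (organ (U)).**  Same binders as `nonempty_dualPair_quotient_idealTorsion_geometric`; the conclusion names
the produced dual pair `DQ` of `A∕K` (★ `dualPairOfQuotientRigidified`, dual abelian scheme `Â∕λ_*K₂`) AND records its unit pin
`𝒫_Q|_{(A∕K) × {ε}} ≅ 𝒪` (★ `nonempty_unitHatSlice_dualPairOfQuotientRigidified_iso` from `hD`) — the input `hDQ` of ★
`RoofMiddleTransportAlongIso.nonempty_pullback_unitHatSlice_ofIso_iso` (the `J12` pin of `Roof₀` for `DB := DQ.ofIso E`), which the bare `Nonempty (…).DualPair`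
of the head forgets. [cite: MumfordAV1970, §15 Thm. 1 (p. 143)] [cite: MumfordFogartyKirwan1994, Ch. 6 §2 Def. 6.2–6.3 (p. 120)] -/
theorem exists_dualPair_quotient_idealTorsion_geometric_of_unit {g : ℕ} (hA : A.IsOfRelDim g) (lam : A.X ⟶ D.hat.X) [IsMonHom lam]
    (hpol : ∀ ⦃Ω' : Type u⦄ [Field Ω'] [IsAlgClosed Ω'] (s : Spec (.of Ω') ⟶ Spec (.of Ω)),
      ∃ Θ : CartierDivisor (A.fibre s).toAbelianVariety.X.left, A.IsLambdaOfAt s D lam Θ)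
    {O : Type v} [CommRing O] [IsDedekindDomain O] (act : A.RingAction O)
    (hsurj : ∀ ⦃Ω' : Type u⦄ [Field Ω'] [IsAlgClosed Ω'] (s : Spec (.of Ω') ⟶ Spec (.of Ω)) (r : O), r ≠ 0 →
      haveI := act.isMonHom r
      Function.Surjective (fun x : (A.fibre s).toAbelianVariety.Points Ω' => AlgPoints.map (fibreHom (act.i r) s).hom.hom.hom x))
    {n : ℕ} (hn0 : (n : Ω) ≠ 0) {𝔟 𝔟' 𝔠 : Ideal O} (h𝔟'0 : 𝔟' ≠ ⊥) (h𝔠 : 𝔠 * 𝔟' = Ideal.span {(n : O)})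
    (hros : ∀ ⦃Ω' : Type u⦄ [Field Ω'] [IsAlgClosed Ω'] (s : Spec (.of Ω') ⟶ Spec (.of Ω)), ∀ j ∈ 𝔟', j ≠ 0 → ∃ b ∈ 𝔟,
      (haveI := act.isMonHom b; IsDominant (AbelianVariety.Hom.toSchemeHom (fibreHom (act.i b) s))) ∧
      (haveI := act.isMonHom b; act.i j ≫ lam = lam ≫ DualPair.dualIsogenyOver (act.i b) D D))
    (K : Subgroup A.Sections) [Finite K] (hK : ∀ σ : K, (σ : A.Sections) ^ n = 1) (hK𝔟 : ∀ (κ : K), ∀ b ∈ 𝔟, (κ : A.Sections) ≫ act.i b = 1)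
    (K₂ : Subgroup A.Sections) [Finite K₂] (hK₂ : ∀ σ : K₂, (σ : A.Sections) ^ n = 1) (hK₂𝔠 : ∀ (σ : K₂), ∀ r ∈ 𝔠, (σ : A.Sections) ≫ act.i r = 1)
    (φ : LevelStructure g n D.hat)
    (hK'φ : ((K₂.map (IsMonHom.monoidHom lam (𝟙_ (Over (Spec (.of Ω)))))) : Set D.hat.Sections) ⊆ Set.range φ.section_)
    (hcard : Nat.card K * Nat.card (K₂.map (IsMonHom.monoidHom lam (𝟙_ (Over (Spec (.of Ω)))))) = n ^ (2 * g)) :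
    ∃ DQ : (A.quotientBy (𝟙 (Spec (.of Ω))) K (A.hcov_of_field K)
      (A.exists_grpObj_isMonHom_quotientMk_of_field K (A.hcov_of_field K))
      (A.smooth_quotientOver_hom_of_field K (A.hcov_of_field K))
      (A.geometricallyConnected_quotientOver_hom (𝟙 (Spec (.of Ω))) K (A.hcov_of_field K))).DualPair,
      Nonempty ((Scheme.Modules.pullback (DualPair.unitHatSlice DQ)).obj DQ.P ≅ SheafOfModules.unit _) := by
  -- ### (0) the total spaces are reduced and locally Noetherian
  haveI : IsReduced A.X.left := A.isReduced_left
  haveI : IsReduced D.hat.X.left := D.hat.isReduced_left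
  haveI := A.isSmooth
  haveI := D.hat.isSmooth
  haveI : IsLocallyNoetherian A.X.left := LocallyOfFiniteType.isLocallyNoetherian A.X.hom
  haveI : IsLocallyNoetherian D.hat.X.left := LocallyOfFiniteType.isLocallyNoetherian D.hat.X.hom
  -- ### (1) the quotient binders for `(A, K)` over the field
  have hcov := A.hcov_of_field K
  have hG := A.exists_grpObj_isMonHom_quotientMk_of_field K hcov
  have hsm := A.smooth_quotientOver_hom_of_field K hcov
  have hgc := A.geometricallyConnected_quotientOver_hom (𝟙 (Spec (.of Ω))) K hcov
  have hfree := A.translation_free_of_field K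
  -- ### (2) `K′ := λ_*K₂`, finite, and the quotient binders for `(Â, K′)`
  let K' : Subgroup D.hat.Sections := K₂.map (IsMonHom.monoidHom lam (𝟙_ (Over (Spec (.of Ω)))))
  haveI : Finite K' := A.finite_map_isMonHom_monoidHom lam K₂
  have hcov' := D.hat.hcov_of_field K'
  have hG' := D.hat.exists_grpObj_isMonHom_quotientMk_of_field K' hcov'
  have hsm' := D.hat.smooth_quotientOver_hom_of_field K' hcov'
  have hgc' := D.hat.geometricallyConnected_quotientOver_hom (𝟙 (Spec (.of Ω))) K' hcov'
  have hfree' := D.hat.translation_free_of_field K'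
  -- ### (3) `hD`: the unit slice of `𝒫` along `1 × ε_Â` is trivial (`λ̄ = Λ(𝒪(Θ))` at the closed point)
  obtain ⟨Θ₁, hΘ₁⟩ := hpol (𝟙 (Spec (.of Ω)))
  have hD := DualPair.nonempty_unitHatSlice_iso_of_isLambdaOfAt D lam hΘ₁
  -- ### (4) `n` is invertible at every geometric point and in every residue field
  have hn : ∀ ⦃Ω' : Type u⦄ [Field Ω'] [IsAlgClosed Ω'] (s : Spec (.of Ω') ⟶ Spec (.of Ω)), (n : Ω') ≠ 0 := by
    intro Ω' _ _ s h
    have c : Ω →+* Ω' := (Spec.preimage s).hom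
    exact hn0 ((map_eq_zero_iff c c.injective).1 ((map_natCast c n).trans h))
  have hnres : ∀ s : Spec (.of Ω), (n : (Spec (.of Ω)).residueField s) ≠ 0 := fun s => natCast_residueField_ne_zero_of_specMap (𝟙 (Spec (.of Ω))) s hn0
  -- ### (5) ISOTROPY: `hiso₂` (★ H3 socket closer) ⇒ `K′ ≤ Stab(𝒩₁)` (★ H2) ⇒ `Φ`
  have hiso₂ := A.hiso_of_idealTorsion_of_rosati (𝟙 (Spec (.of Ω))) K hK hcov hG hsm hgc D hfree lam hA hn hpol act hsurj h𝔟'0 h𝔠 hros hK𝔟 K₂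
    hK₂ hK₂𝔠
  have hK'stab := A.map_le_poincareStabilizerSubgroup_of_subgroup (𝟙 (Spec (.of Ω))) K hK hcov hG hsm hgc D hfree hD lam K₂ hK₂ hiso₂
  let Φ := A.poincareStabilizerStructure (𝟙 (Spec (.of Ω))) K hK hcov hG hsm hgc D hfree K' hcov' hK'stab
  -- ### (6) `h4` from the hat level structure, the count and the characteristic-free (K); the pair and its unit pin
  exact ⟨A.dualPairOfQuotientRigidified (𝟙 (Spec (.of Ω))) K hK hcov hG hsm hgc D hfree K' hcov' hG' hsm' hgc' hfree' Φ
      (A.universal_poincareQuotRigid_of_level_of_desc (𝟙 (Spec (.of Ω))) K hK hcov hG hsm hgc D hfree K' hcov' hG' hsm' hgc' hfree' Φ φ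
        hnres hcard hD
        (fun f a a' ha ha' h => A.hStab_of_level_of_natCard_eq_geometric (𝟙 (Spec (.of Ω))) K hK hcov hG hsm hgc D hfree K' hcov' Ω
          (𝟙 (Spec (.of Ω))) hA hn0 hD φ hK'φ hK'stab hcard f a a' ha ha' h)),
    A.nonempty_unitHatSlice_dualPairOfQuotientRigidified_iso (𝟙 (Spec (.of Ω))) K hK hcov hG hsm hgc D hfree K' hcov' hG' hsm' hgc'
      hfree' Φ _ hD⟩

end Literature.AlgebraicGeometry.AbelianSchemes.AbelianSchemeOver

end
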